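import Literature.Geometry.Kaehler.ComplexTorusHodgeGroupSymplecticRealComplex
import Literature.NumberTheory.Automorphic.LieAlgebraGLConjReindex
import HarnessLib

/-!
# `Sp(V, E)(ℂ)` has a simple Lie algebra for EVERY non-degenerate alternating form: a polarised complex torus /
# abelian variety with `Hg(X) = Sp(V, E)` — any lattice basis, any polarisation — has simple `Lie Hg(X)(ℂ)` and
# `dim Hg(X) = g(2g+1)`; the product and (D) theorems without the Gram-`J` restriction

Layer `Literature/Geometry/Kaehler`, namespace `Literature.Geometry.Kaehler.ComplexTorus`; lane `lit-hodgefound`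
(Track 2 foundations library), Layer A3/A4; prover seat `lit-hodgefound-p17` (generation 39, self-proposed row
g39-#7b, the consumer of the LAG supplier g39-#7a `LieAlgebraGLConjReindex` (Lie-simplicity and `dim` are invariant
under `Int(g)` and reindexing) and of p36's presentation `ComplexTorusSymplecticGroupGramConnected.complexPoints_symplecticEqs_eq_map`
("`Sp_G(ℂ) = P · (Sp_{2n}(ℂ) reindexed) · P⁻¹`"), removing the hypothesis "lattice Gram matrix `J` on an index type
`l ⊕ l`" from g39-#5/#6). THEOREMS ONLY (no definition, no instance, no notation, no named fact; D-0026 net debt 0).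

## Sources, verbatim

* H. Lange [Lange2023AbelianVarietiesComplex], §7.3.1 Prop. 7.3.2: "For a general member of the family […]
  `Hg(X) = Sp(V, E)`", proof of Prop. 7.3.3: "`Hg(X)(ℂ) = Sp(V, E)(ℂ) ≃ Sp_{2g}(ℂ)`"; §7.2.1 Prop. 7.2.3
  (`Hg(X) ⊆ Sp(V, E)`).
* D. McDuff, D. Salamon [McDuffSalamon2017], Thm. 2.1.3 (every symplectic form has a standard basis: `ᵗP G P = J`).
* T. A. Springer [Springer1998], 7.4.7 (3)(b) ("`G = Sp_{2n}` […] is connected, semi-simple of type `C_n`"),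
  4.4.5 (ii) (`Ad(x)` is an automorphism of the Lie algebra), 1.8.1.
* J. E. Humphreys [Humphreys1972], §19.2; B. C. Hall [Hall2015], Cor. 8.47 (`𝔰𝔭` is simple).
* B. Moonen, Yu. G. Zarhin [MoonenZarhin1999LowDim], §3 (3.1), Theorem (2); B. B. Gordon [Gordon1997], §2.16 Proposition,
  §3 Theorem; [Gordon1999HodgeAVSurvey], Thm. 6.2, Thm. 7.5, Thm. 7.6.2.

## What is proved

* §1 transport to `GL`: `map_toGL_map_reindexSLC`, `map_toGL_map_conjGLC` (the lane's `reindexSLC`, `conjGLC` on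
  `SL_ι(ℂ)` versus the LAG library's `reindexGL`, `MulAut.conj` on `GL_ι(ℂ)`).
* §2 **`isSimple_lieSubalgebraGL_map_toGL_complexPoints_symplecticEqs`**: for a skew rational `G` with `det G ≠ 0` on a
  non-empty index type, `Lie Sp_G(ℂ)` is simple; `zdim_map_toGL_eq_of_eq_conjGLC_reindexSLC_symplecticGroupC`,
  **`two_mul_zdim_map_toGL_complexPoints_symplecticEqs`** (`2 dim Sp_G = |ι|(|ι|+1)`).
* §3 ANY POLARISED TORUS (`Φ : (ι → ℝ) ≃ E`, `IsRiemannForm Φ η`): **`IsRiemannForm.isSimple_lieSubalgebraGL_hodgeGroupC`**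
  (`Hg(X) = Sp(V,E) ⟹ Lie Hg(X)(ℂ)` simple), **`IsRiemannForm.zdim_hodgeGroupC_eq_of_hodgeGroup_eq_spGroup`**
  (`dim Hg(X) = g(2g+1)`), `…radical…`, `…not_isSolvable…`, `IsRiemannForm.not_isCMType_of_hodgeGroup_eq_spGroup`
  (perfectness and the commutative ∕ CM second-factor products are already gen-37's
  `ComplexTorusStablyNondegenerateProductPerfectFactor`),
  the real criteria **`IsRiemannForm.isSimple_lieSubalgebraGL_hodgeGroupC_of_finrank_hodgeGroupLie_eq`** (`dim_ℝ 𝔥𝔤_ℝ =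
  g(2g+1)`) and **`IsRiemannForm.isSimple_lieSubalgebraGL_hodgeGroupC_of_forall_divisorClasses_eq_hodgeClasses`** (stably
  nondegenerate with `End_ℚ(X) = ℚ`).
* §4 PRODUCTS, any polarised `X₁` with `Hg(X₁) = Sp(V₁, E₁)` and any torus `X₂`: **`IsRiemannForm.hodgeGroupC_prod_eq_blockDiagProd_of_zdim_lt`**
  (`dim Hg(X₂) < g₁(2g₁+1)`), `…_of_isSolvable` (solvable `Hg(X₂)(ℂ)`), real points, the (D)-transfers
  **`IsRiemannForm.forall_divisorClasses_powPeriod_prod_eq_hodgeClasses_of_zdim_lt`** ∕ `_of_isSolvable`, and for two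
  polarised Hodge-general factors of different dimensions
  **`IsRiemannForm.hodgeGroupC_prod_eq_blockDiagProd_of_finrank_ne`**,
  **`IsRiemannForm.forall_divisorClasses_powPeriod_prod_eq_hodgeClasses_of_finrank_ne`**.

## References

* [Lange2023AbelianVarietiesComplex] H. Lange, *Abelian Varieties over the Complex Numbers* (2023), Prop. 7.2.3, 7.3.2, 7.3.3.
* [McDuffSalamon2017] D. McDuff, D. Salamon, *Introduction to Symplectic Topology*, 3rd ed. (2017), Thm. 2.1.3.
* [Springer1998] T. A. Springer, *Linear Algebraic Groups*, 2nd ed. (1998), 7.4.7, 4.4.5, 1.8.1.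
* [Humphreys1972] J. E. Humphreys, GTM 9 (1972), §19.2. [Hall2015] B. C. Hall, GTM 222 (2015), Cor. 8.47.
* [MoonenZarhin1999LowDim] B. Moonen, Yu. G. Zarhin, Math. Ann. 315 (1999), §3.
* [Gordon1997] B. B. Gordon, alg-geom/9709030, §2.12, §2.16, §3. [Gordon1999HodgeAVSurvey] Thm. 6.2, 7.5, 7.6.2.
-/

noncomputable section

open Matrix Module

namespace Literature.Geometry.Kaehler

namespace ComplexTorus

open Literature.NumberTheory.Automorphic (IsZConnected lieAlgebraGL lieSubalgebraGL reindexGL radical IsConnectedReductive)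

/-! ## §1 The lane's `SL`-level isomorphisms versus the LAG library's `GL`-level ones -/

section Transport

variable {ι κ : Type*} [Fintype ι] [DecidableEq ι] [Fintype κ] [DecidableEq κ]

/-- `toGL ∘ reindexSLC e = reindexGL e ∘ toGL` on subgroups of `SL_ι(ℂ)`. [folklore] [cite: Springer1998, 2.1.4] -/
theorem map_toGL_map_reindexSLC (K : Subgroup (SpecialLinearGroup ι ℂ)) (e : ι ≃ κ) :
    (K.map (reindexSLC e).toMonoidHom).map Matrix.SpecialLinearGroup.toGL =
      (K.map Matrix.SpecialLinearGroup.toGL).map (reindexGL e).toMonoidHom := by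
  rw [Subgroup.map_map, Subgroup.map_map]
  congr 1
  refine MonoidHom.ext fun M ↦ Units.ext ?_
  rfl

/-- `toGL ∘ conjGLC P = Int(P) ∘ toGL` on subgroups of `SL_ι(ℂ)` (`P ∈ GL_ι(ℂ)`). [folklore] [cite: Springer1998, 2.1.4] -/
theorem map_toGL_map_conjGLC (K : Subgroup (SpecialLinearGroup ι ℂ)) {P : Matrix ι ι ℂ} (hP : IsUnit P.det) :
    (K.map (conjGLC P hP).toMonoidHom).map Matrix.SpecialLinearGroup.toGL =
      (K.map Matrix.SpecialLinearGroup.toGL).map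
        (MulAut.conj (Matrix.GeneralLinearGroup.mk'' P hP) : GL ι ℂ →* GL ι ℂ) := by
  rw [Subgroup.map_map, Subgroup.map_map]
  congr 1
  refine MonoidHom.ext fun M ↦ Units.ext ?_
  change P * (M : Matrix ι ι ℂ) * P⁻¹ =
    ((Matrix.GeneralLinearGroup.mk'' P hP : GL ι ℂ) : Matrix ι ι ℂ) * (M : Matrix ι ι ℂ) *
      (((Matrix.GeneralLinearGroup.mk'' P hP)⁻¹ : GL ι ℂ) : Matrix ι ι ℂ)
  rw [Matrix.coe_units_inv]
  rfl

end Transport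

/-! ## §2 `Lie Sp(V, E)(ℂ)` is simple for every non-degenerate rational alternating form -/

section Gram

variable {ι : Type*} [Fintype ι] [DecidableEq ι]

/-- **`dim (P · Sp_{2n}(ℂ)^{e} · P⁻¹) = n(2n+1)`**: the LAG dimension of a conjugate of a reindexed standard symplectic
group. [cite: Springer1998, 7.4.7 (3)(b), 4.4.5 (ii) and 1.8.1] -/
theorem zdim_map_toGL_eq_of_eq_conjGLC_reindexSLC_symplecticGroupC {K : Subgroup (SpecialLinearGroup ι ℂ)}
    (hK : IsZConnected (K.map Matrix.SpecialLinearGroup.toGL)) {n : ℕ} (e : ι ≃ Fin n ⊕ Fin n) {P : Matrix ι ι ℂ}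
    (hP : IsUnit P.det)
    (h : K = ((symplecticGroupC (Fin n)).map (reindexSLC e.symm).toMonoidHom).map (conjGLC P hP).toMonoidHom) :
    hK.zdim = n * (2 * n + 1) := by
  have hZ := ((isZConnected_map_toGL_symplecticGroupC (Fin n)).map_reindexGL e.symm).map_conj
    (Matrix.GeneralLinearGroup.mk'' P hP)
  have hKe : K.map Matrix.SpecialLinearGroup.toGL =
      ((((symplecticGroupC (Fin n)).map Matrix.SpecialLinearGroup.toGL).map (reindexGL e.symm).toMonoidHom).map
        (MulAut.conj (Matrix.GeneralLinearGroup.mk'' P hP) : GL ι ℂ →* GL ι ℂ)) := by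
    rw [h, map_toGL_map_conjGLC, map_toGL_map_reindexSLC]
  rw [hK.zdim_congr hZ hKe, ((isZConnected_map_toGL_symplecticGroupC (Fin n)).map_reindexGL e.symm).zdim_map_conj,
    (isZConnected_map_toGL_symplecticGroupC (Fin n)).zdim_map_reindexGL, zdim_map_toGL_symplecticGroupC, Fintype.card_fin]

omit [DecidableEq ι] in
/-- `|ι| = 2n` along `e : ι ≃ Fin n ⊕ Fin n`. [folklore] -/
private theorem card_eq_of_equiv_sum {n : ℕ} (e : ι ≃ Fin n ⊕ Fin n) : Fintype.card ι = n + n := by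
  rw [Fintype.card_congr e, Fintype.card_sum, Fintype.card_fin]

/-- **`Lie Sp(V, E)(ℂ)` IS SIMPLE** for every skew-symmetric rational `G` with `det G ≠ 0` on a non-empty index type:
`Sp_G(ℂ)` is a `GL`-conjugate of a reindexed `Sp_{2n}(ℂ)` (`n ≥ 1`), whose Lie algebra `𝔰𝔭_{2n}(ℂ)` is simple, and
Lie-simplicity is invariant under `Int(g)` and reindexing. [cite: Lange2023AbelianVarietiesComplex, §7.3.1, proof of Prop. 7.3.3 ("`Sp(V, E)(ℂ) ≃ Sp_{2g}(ℂ)`")]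
[cite: McDuffSalamon2017, Thm. 2.1.3] [cite: Springer1998, 7.4.7 (3)(b) and 4.4.5 (ii)] [cite: Humphreys1972, §19.2] -/
theorem isSimple_lieSubalgebraGL_map_toGL_complexPoints_symplecticEqs [Nonempty ι] {G : Matrix ι ι ℚ}
    (hGt : Gᵀ = -G) (hdet : G.det ≠ 0) :
    LieAlgebra.IsSimple ℂ (lieSubalgebraGL
      (((isRatAlgSubgroupEqs_symplecticEqs G).complexPoints).map Matrix.SpecialLinearGroup.toGL)) := by
  obtain ⟨n, e, P, hP, h⟩ := complexPoints_symplecticEqs_eq_map hGt hdet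
  haveI : Nonempty (Fin n) := by
    have hc := card_eq_of_equiv_sum e
    have h0 : 0 < Fintype.card ι := Fintype.card_pos
    exact ⟨⟨0, by omega⟩⟩
  rw [h, map_toGL_map_conjGLC, Literature.NumberTheory.Automorphic.isSimple_lieSubalgebraGL_map_conj_iff,
    map_toGL_map_reindexSLC, Literature.NumberTheory.Automorphic.isSimple_lieSubalgebraGL_map_reindexGL_iff]
  exact isSimple_lieSubalgebraGL_map_toGL_symplecticGroupC (Fin n)

/-- **`2 · dim Sp(V, E)(ℂ) = |ι|(|ι|+1)`** (`dim Sp_{2n} = n(2n+1)`, `|ι| = 2n`), for the lane's `IsZConnected` witness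
of any subgroup equal to `Sp_G(ℂ)`. [cite: Springer1998, 7.4.7 (3)(b) and 1.8.1] [cite: McDuffSalamon2017, Thm. 2.1.3] -/
theorem two_mul_zdim_map_toGL_complexPoints_symplecticEqs {G : Matrix ι ι ℚ} (hGt : Gᵀ = -G) (hdet : G.det ≠ 0)
    {K : Subgroup (SpecialLinearGroup ι ℂ)} (hK : IsZConnected (K.map Matrix.SpecialLinearGroup.toGL))
    (hKG : K = (isRatAlgSubgroupEqs_symplecticEqs G).complexPoints) :
    2 * hK.zdim = Fintype.card ι * (Fintype.card ι + 1) := by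
  obtain ⟨n, e, P, hP, h⟩ := complexPoints_symplecticEqs_eq_map hGt hdet
  rw [zdim_map_toGL_eq_of_eq_conjGLC_reindexSLC_symplecticGroupC hK e hP (hKG.trans h), card_eq_of_equiv_sum e]
  ring

end Gram

/-! ## §3 Any polarised torus with `Hg(X) = Sp(V, E)` -/

section Hodge

variable {ι : Type*} [Fintype ι] [DecidableEq ι] {E : Type*} [NormedAddCommGroup E] [NormedSpace ℂ E]
  {Φ : (ι → ℝ) ≃L[ℝ] E}

/-- **`Hg(X) = Sp(V, E) ⟹ Lie Hg(X)(ℂ)` IS SIMPLE — for EVERY polarised complex torus / abelian variety** (any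
lattice basis, any polarisation; `X ≠ 0`). [cite: Lange2023AbelianVarietiesComplex, §7.3.1 Prop. 7.3.2 and proof of Prop. 7.3.3]
[cite: Springer1998, 7.4.7 (3)(b)] [cite: Humphreys1972, §19.2] -/
theorem IsRiemannForm.isSimple_lieSubalgebraGL_hodgeGroupC [Nonempty ι] {η : E [⋀^Fin 2]→L[ℝ] ℝ}
    (hη : IsRiemannForm Φ η) (h : hodgeGroup Φ = spGroup Φ η) :
    LieAlgebra.IsSimple ℂ (lieSubalgebraGL ((hodgeGroupC Φ).map Matrix.SpecialLinearGroup.toGL)) := by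
  obtain ⟨G, hG, hdetu⟩ := hη.exists_ratMatrix_latticeGram_isUnit
  rw [hη.hodgeGroupC_eq_complexPoints_symplecticEqs_of_hodgeGroup_eq_spGroup hG h]
  exact isSimple_lieSubalgebraGL_map_toGL_complexPoints_symplecticEqs (transpose_eq_neg_of_map_ratCast Φ hG)
    hdetu.ne_zero

/-- **`Hg(X) = Sp(V, E) ⟹ dim Hg(X) = g(2g+1)`** (`g = dim_ℂ X`; any polarised torus).
[cite: Lange2023AbelianVarietiesComplex, §7.3.1, proof of Prop. 7.3.3 ("`≃ Sp_{2g}(ℂ)`")] [cite: Springer1998, 7.4.7 (3)(b) and 1.8.1] -/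
theorem IsRiemannForm.zdim_hodgeGroupC_eq_of_hodgeGroup_eq_spGroup [FiniteDimensional ℂ E] {η : E [⋀^Fin 2]→L[ℝ] ℝ}
    (hη : IsRiemannForm Φ η) (h : hodgeGroup Φ = spGroup Φ η) :
    (isZConnected_map_toGL_hodgeGroupC Φ).zdim = finrank ℂ E * (2 * finrank ℂ E + 1) := by
  obtain ⟨G, hG, hdetu⟩ := hη.exists_ratMatrix_latticeGram_isUnit
  have h2 := two_mul_zdim_map_toGL_complexPoints_symplecticEqs (transpose_eq_neg_of_map_ratCast Φ hG) hdetu.ne_zero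
    (isZConnected_map_toGL_hodgeGroupC Φ) (hη.hodgeGroupC_eq_complexPoints_symplecticEqs_of_hodgeGroup_eq_spGroup hG h)
  have hc := card_eq_two_mul_finrank Φ
  rw [hc] at h2
  have h4 : 2 * (isZConnected_map_toGL_hodgeGroupC Φ).zdim = 2 * (finrank ℂ E * (2 * finrank ℂ E + 1)) := by
    rw [h2]; ring
  omega

/-- `Hg(X) = Sp(V, E) ⟹ dim_ℂ Lie Hg(X)(ℂ) = g(2g+1)`. [cite: Lange2023AbelianVarietiesComplex, §7.3.1, proof of Prop. 7.3.2] [cite: Springer1998, 4.4.6] -/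
theorem IsRiemannForm.finrank_lieAlgebraGL_hodgeGroupC_eq_of_hodgeGroup_eq_spGroup [FiniteDimensional ℂ E]
    {η : E [⋀^Fin 2]→L[ℝ] ℝ} (hη : IsRiemannForm Φ η) (h : hodgeGroup Φ = spGroup Φ η) :
    finrank ℂ (lieAlgebraGL ((hodgeGroupC Φ).map Matrix.SpecialLinearGroup.toGL)) = finrank ℂ E * (2 * finrank ℂ E + 1) := by
  rw [(isZConnected_map_toGL_hodgeGroupC Φ).finrank_lieAlgebraGL_eq.2, hη.zdim_hodgeGroupC_eq_of_hodgeGroup_eq_spGroup h]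

/-- `Hg(X) = Sp(V, E) ⟹ R(Hg(X)(ℂ)) = 1` (semisimple). [cite: Springer1998, 7.4.7 (3)(b)] [cite: Gordon1997, Def. 1.3] -/
theorem IsRiemannForm.radical_map_toGL_hodgeGroupC_eq_bot_of_hodgeGroup_eq_spGroup [Nonempty ι]
    {η : E [⋀^Fin 2]→L[ℝ] ℝ} (hη : IsRiemannForm Φ η) (h : hodgeGroup Φ = spGroup Φ η) :
    radical ((hodgeGroupC Φ).map Matrix.SpecialLinearGroup.toGL) = ⊥ :=
  radical_map_toGL_hodgeGroupC_eq_bot_of_isSimple_lieSubalgebraGL Φ (hη.isSimple_lieSubalgebraGL_hodgeGroupC h)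

/-- `Hg(X) = Sp(V, E) ⟹ Hg(X)(ℂ)` is not solvable. [cite: Springer1998, 7.4.7 (3)(b)] [cite: Milne2017, Def 19.7] -/
theorem IsRiemannForm.not_isSolvable_hodgeGroupC_of_hodgeGroup_eq_spGroup [Nonempty ι] {η : E [⋀^Fin 2]→L[ℝ] ℝ}
    (hη : IsRiemannForm Φ η) (h : hodgeGroup Φ = spGroup Φ η) : ¬ IsSolvable ↥(hodgeGroupC Φ) :=
  not_isSolvable_hodgeGroupC_of_isSimple_lieSubalgebraGL Φ (hη.isSimple_lieSubalgebraGL_hodgeGroupC h)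

/-- **A polarised abelian variety with `Hg(X) = Sp(V, E)` is not of CM-type.** [cite: Gordon1997, §2.12 Proposition]
[cite: MoonenZarhin1999LowDim, §1] -/
theorem IsRiemannForm.not_isCMType_of_hodgeGroup_eq_spGroup [Nonempty ι] {η : E [⋀^Fin 2]→L[ℝ] ℝ}
    (hη : IsRiemannForm Φ η) (h : hodgeGroup Φ = spGroup Φ η) :
    ¬ ∃ T : Subalgebra ℚ (Matrix ι ι ℚ), T ≤ endAlgRat Φ ∧ IsReduced T ∧ (∀ a ∈ T, ∀ b ∈ T, a * b = b * a) ∧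
      Module.finrank ℚ T = Fintype.card ι :=
  IsAbelianVariety.not_isCMType_of_isSimple_lieSubalgebraGL ⟨η, hη⟩ (hη.isSimple_lieSubalgebraGL_hodgeGroupC h)

/-- **`dim_ℝ 𝔥𝔤_ℝ = g(2g+1) ⟹ Lie Hg(X)(ℂ)` is simple** (the lane's real dimension criterion, any polarised torus).
[cite: Lange2023AbelianVarietiesComplex, §7.3.1, proof of Prop. 7.3.2 (pp. 337–338)] [cite: Humphreys1972, §19.2] -/
theorem IsRiemannForm.isSimple_lieSubalgebraGL_hodgeGroupC_of_finrank_hodgeGroupLie_eq [Nonempty ι]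
    [FiniteDimensional ℂ E] {η : E [⋀^Fin 2]→L[ℝ] ℝ} (hη : IsRiemannForm Φ η)
    (h : finrank ℝ (hodgeGroupLie Φ) = finrank ℂ E * (2 * finrank ℂ E + 1)) :
    LieAlgebra.IsSimple ℂ (lieSubalgebraGL ((hodgeGroupC Φ).map Matrix.SpecialLinearGroup.toGL)) :=
  hη.isSimple_lieSubalgebraGL_hodgeGroupC (hη.hodgeGroup_eq_spGroup_iff_finrank_hodgeGroupLie_eq.2 h)

/-- **A stably nondegenerate polarised torus with `End_ℚ(X) = ℚ` has simple `Lie Hg(X)(ℂ)`** (Gordon 7.5 (1) ⟹ (2),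
any polarised torus). [cite: Gordon1999HodgeAVSurvey, Thm. 7.5 and Thm. 6.2] [cite: Lange2023AbelianVarietiesComplex, §7.2.4 Exercise (4)]
[cite: Humphreys1972, §19.2] -/
theorem IsRiemannForm.isSimple_lieSubalgebraGL_hodgeGroupC_of_forall_divisorClasses_eq_hodgeClasses [Nonempty ι]
    [FiniteDimensional ℂ E] {η : E [⋀^Fin 2]→L[ℝ] ℝ} (hη : IsRiemannForm Φ η) (hE : endAlgRat Φ = ⊥)
    (hD : ∀ k p : ℕ, divisorClasses (powPeriod Φ k) p = hodgeClasses (powPeriod Φ k) p) :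
    LieAlgebra.IsSimple ℂ (lieSubalgebraGL ((hodgeGroupC Φ).map Matrix.SpecialLinearGroup.toGL)) :=
  hη.isSimple_lieSubalgebraGL_hodgeGroupC
    ((hη.hodgeGroup_eq_spGroup_iff_forall_divisorClasses_eq_hodgeClasses_and_endAlgRat_eq_bot).2 ⟨hD, hE⟩)

/-- `X` stably nondegenerate with `End_ℚ(X) = ℚ` ⟹ `dim Hg(X) = g(2g+1)` (any polarised torus).
[cite: Gordon1999HodgeAVSurvey, Thm. 7.5] [cite: Springer1998, 7.4.7 (3)(b)] -/
theorem IsRiemannForm.zdim_hodgeGroupC_eq_of_forall_divisorClasses_eq_hodgeClasses [FiniteDimensional ℂ E]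
    {η : E [⋀^Fin 2]→L[ℝ] ℝ} (hη : IsRiemannForm Φ η) (hE : endAlgRat Φ = ⊥)
    (hD : ∀ k p : ℕ, divisorClasses (powPeriod Φ k) p = hodgeClasses (powPeriod Φ k) p) :
    (isZConnected_map_toGL_hodgeGroupC Φ).zdim = finrank ℂ E * (2 * finrank ℂ E + 1) :=
  hη.zdim_hodgeGroupC_eq_of_hodgeGroup_eq_spGroup
    ((hη.hodgeGroup_eq_spGroup_iff_forall_divisorClasses_eq_hodgeClasses_and_endAlgRat_eq_bot).2 ⟨hD, hE⟩)

end Hodge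

/-! ## §4 Products with a polarised factor `X₁`, `Hg(X₁) = Sp(V₁, E₁)` -/

section Product

variable {ι₁ ι₂ : Type*} [Fintype ι₁] [DecidableEq ι₁] [Fintype ι₂] [DecidableEq ι₂]
  {E₁ E₂ : Type*} [NormedAddCommGroup E₁] [NormedSpace ℂ E₁] [NormedAddCommGroup E₂] [NormedSpace ℂ E₂]
  {Φ₁ : (ι₁ → ℝ) ≃L[ℝ] E₁} (Φ₂ : (ι₂ → ℝ) ≃L[ℝ] E₂)

/-- **`Hg(X₁) = Sp(V₁, E₁)` and `dim Hg(X₂) < g₁(2g₁+1)` ⟹ `Hg(X₁ × X₂)(ℂ) = Hg(X₁)(ℂ) × Hg(X₂)(ℂ)`** (any polarised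
`X₁`, any torus `X₂`). [cite: MoonenZarhin1999LowDim, §3 (3.1)] [cite: Gordon1997, §2.16 Proposition] [cite: Lange2023AbelianVarietiesComplex, §7.3.1 Prop. 7.3.2] -/
theorem IsRiemannForm.hodgeGroupC_prod_eq_blockDiagProd_of_zdim_lt [Nonempty ι₁] [FiniteDimensional ℂ E₁]
    {η₁ : E₁ [⋀^Fin 2]→L[ℝ] ℝ} (hη₁ : IsRiemannForm Φ₁ η₁) (h₁ : hodgeGroup Φ₁ = spGroup Φ₁ η₁)
    (hlt : (isZConnected_map_toGL_hodgeGroupC Φ₂).zdim < finrank ℂ E₁ * (2 * finrank ℂ E₁ + 1)) :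
    hodgeGroupC (prodPeriod Φ₁ Φ₂) = blockDiagProd (hodgeGroupC Φ₁) (hodgeGroupC Φ₂) :=
  hodgeGroupC_prod_eq_blockDiagProd_of_isSimple_lieSubalgebraGL_of_zdim_lt Φ₁ Φ₂ (hη₁.isSimple_lieSubalgebraGL_hodgeGroupC h₁)
    (by rwa [hη₁.zdim_hodgeGroupC_eq_of_hodgeGroup_eq_spGroup h₁])

/-- `Hg(X₁) = Sp(V₁, E₁)` ⟹ `Hg(X₁ × X₂)` splits or `g₁(2g₁+1) ≤ dim Hg(X₂)`. [cite: MoonenZarhin1999LowDim, §3 (3.1)] [cite: Gordon1997, §2.16 Proposition] -/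
theorem IsRiemannForm.hodgeGroupC_prod_eq_blockDiagProd_or_le_zdim [Nonempty ι₁] [FiniteDimensional ℂ E₁]
    {η₁ : E₁ [⋀^Fin 2]→L[ℝ] ℝ} (hη₁ : IsRiemannForm Φ₁ η₁) (h₁ : hodgeGroup Φ₁ = spGroup Φ₁ η₁) :
    hodgeGroupC (prodPeriod Φ₁ Φ₂) = blockDiagProd (hodgeGroupC Φ₁) (hodgeGroupC Φ₂) ∨
      finrank ℂ E₁ * (2 * finrank ℂ E₁ + 1) ≤ (isZConnected_map_toGL_hodgeGroupC Φ₂).zdim := by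
  rw [← hη₁.zdim_hodgeGroupC_eq_of_hodgeGroup_eq_spGroup h₁]
  exact hodgeGroupC_prod_eq_blockDiagProd_or_zdim_le_of_isSimple_lieSubalgebraGL Φ₁ Φ₂
    (hη₁.isSimple_lieSubalgebraGL_hodgeGroupC h₁)

/-- **`Hg(X₁) = Sp(V₁, E₁)` and `Hg(X₂)(ℂ)` solvable ⟹ split** (Gordon's lemma). [cite: Gordon1997, §2.16 Proposition and §3 Theorem, proof]
[cite: MoonenZarhin1999LowDim, §3 Theorem (2)] -/
theorem IsRiemannForm.hodgeGroupC_prod_eq_blockDiagProd_of_isSolvable [Nonempty ι₁] {η₁ : E₁ [⋀^Fin 2]→L[ℝ] ℝ}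
    (hη₁ : IsRiemannForm Φ₁ η₁) (h₁ : hodgeGroup Φ₁ = spGroup Φ₁ η₁) (h₂ : IsSolvable ↥(hodgeGroupC Φ₂)) :
    hodgeGroupC (prodPeriod Φ₁ Φ₂) = blockDiagProd (hodgeGroupC Φ₁) (hodgeGroupC Φ₂) :=
  hodgeGroupC_prod_eq_blockDiagProd_of_isSimple_lieSubalgebraGL_of_isSolvable Φ₁ Φ₂
    (hη₁.isSimple_lieSubalgebraGL_hodgeGroupC h₁) h₂

/-- Real points under the dimension route. [cite: MoonenZarhin1999LowDim, §3 (3.1)] -/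
theorem IsRiemannForm.hodgeGroup_prod_eq_of_zdim_lt [Nonempty ι₁] [FiniteDimensional ℂ E₁] {η₁ : E₁ [⋀^Fin 2]→L[ℝ] ℝ}
    (hη₁ : IsRiemannForm Φ₁ η₁) (h₁ : hodgeGroup Φ₁ = spGroup Φ₁ η₁)
    (hlt : (isZConnected_map_toGL_hodgeGroupC Φ₂).zdim < finrank ℂ E₁ * (2 * finrank ℂ E₁ + 1)) :
    hodgeGroup (prodPeriod Φ₁ Φ₂) = ((hodgeGroup Φ₁).prod (hodgeGroup Φ₂)).map (blockDiag ι₁ ι₂) :=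
  hodgeGroup_prod_eq_of_hodgeGroupC_prod_eq (hη₁.hodgeGroupC_prod_eq_blockDiagProd_of_zdim_lt Φ₂ h₁ hlt)

/-- Real points under Gordon's lemma. [cite: Gordon1997, §2.16 Proposition and §3 Theorem, proof] -/
theorem IsRiemannForm.hodgeGroup_prod_eq_of_isSolvable [Nonempty ι₁] {η₁ : E₁ [⋀^Fin 2]→L[ℝ] ℝ}
    (hη₁ : IsRiemannForm Φ₁ η₁) (h₁ : hodgeGroup Φ₁ = spGroup Φ₁ η₁) (h₂ : IsSolvable ↥(hodgeGroupC Φ₂)) :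
    hodgeGroup (prodPeriod Φ₁ Φ₂) = ((hodgeGroup Φ₁).prod (hodgeGroup Φ₂)).map (blockDiag ι₁ ι₂) :=
  hodgeGroup_prod_eq_of_hodgeGroupC_prod_eq (hη₁.hodgeGroupC_prod_eq_blockDiagProd_of_isSolvable Φ₂ h₁ h₂)

/-- **(D)-transfer, dimension route, any polarised `X₁` with `End_ℚ(X₁) = ℚ`: (D) on all powers of `X₁` and of `X₂`,
`dim Hg(X₂) < g₁(2g₁+1)` ⟹ (D) on all powers of `X₁ × X₂`.** [cite: Gordon1999HodgeAVSurvey, Thm. 7.5 and Thm. 7.6.2]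
[cite: MoonenZarhin1999LowDim, §3 (3.1)] -/
theorem IsRiemannForm.forall_divisorClasses_powPeriod_prod_eq_hodgeClasses_of_zdim_lt [Nonempty ι₁]
    [FiniteDimensional ℂ E₁] {η₁ : E₁ [⋀^Fin 2]→L[ℝ] ℝ} (hη₁ : IsRiemannForm Φ₁ η₁) (hE₁ : endAlgRat Φ₁ = ⊥)
    (hX₁ : ∀ k p, divisorClasses (powPeriod Φ₁ k) p = hodgeClasses (powPeriod Φ₁ k) p)
    (hlt : (isZConnected_map_toGL_hodgeGroupC Φ₂).zdim < finrank ℂ E₁ * (2 * finrank ℂ E₁ + 1))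
    (hX₂ : ∀ k p, divisorClasses (powPeriod Φ₂ k) p = hodgeClasses (powPeriod Φ₂ k) p) :
    ∀ k p, divisorClasses (powPeriod (prodPeriod Φ₁ Φ₂) k) p = hodgeClasses (powPeriod (prodPeriod Φ₁ Φ₂) k) p :=
  forall_divisorClasses_powPeriod_prod_eq_hodgeClasses_of_hodgeGroupC_prod_eq
    (hη₁.hodgeGroupC_prod_eq_blockDiagProd_of_zdim_lt Φ₂
      ((hη₁.hodgeGroup_eq_spGroup_iff_forall_divisorClasses_eq_hodgeClasses_and_endAlgRat_eq_bot).2 ⟨hX₁, hE₁⟩) hlt)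
    hX₁ hX₂

/-- **(D)-transfer, Gordon's lemma, any polarised `X₁` with `End_ℚ(X₁) = ℚ`: (D) on all powers of `X₁` and of `X₂`,
`Hg(X₂)(ℂ)` solvable ⟹ (D) on all powers of `X₁ × X₂`.** [cite: Gordon1999HodgeAVSurvey, Thm. 7.5 and Thm. 7.6.2]
[cite: Gordon1997, §3 Theorem, proof] -/
theorem IsRiemannForm.forall_divisorClasses_powPeriod_prod_eq_hodgeClasses_of_isSolvable [Nonempty ι₁]
    [FiniteDimensional ℂ E₁] {η₁ : E₁ [⋀^Fin 2]→L[ℝ] ℝ} (hη₁ : IsRiemannForm Φ₁ η₁) (hE₁ : endAlgRat Φ₁ = ⊥)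
    (hX₁ : ∀ k p, divisorClasses (powPeriod Φ₁ k) p = hodgeClasses (powPeriod Φ₁ k) p)
    (h₂ : IsSolvable ↥(hodgeGroupC Φ₂))
    (hX₂ : ∀ k p, divisorClasses (powPeriod Φ₂ k) p = hodgeClasses (powPeriod Φ₂ k) p) :
    ∀ k p, divisorClasses (powPeriod (prodPeriod Φ₁ Φ₂) k) p = hodgeClasses (powPeriod (prodPeriod Φ₁ Φ₂) k) p :=
  forall_divisorClasses_powPeriod_prod_eq_hodgeClasses_of_hodgeGroupC_prod_eq
    (hη₁.hodgeGroupC_prod_eq_blockDiagProd_of_isSolvable Φ₂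
      ((hη₁.hodgeGroup_eq_spGroup_iff_forall_divisorClasses_eq_hodgeClasses_and_endAlgRat_eq_bot).2 ⟨hX₁, hE₁⟩) h₂)
    hX₁ hX₂

end Product

/-! ## §5 Two polarised Hodge-general factors of different dimensions -/

section Two

variable {ι₁ ι₂ : Type*} [Fintype ι₁] [DecidableEq ι₁] [Fintype ι₂] [DecidableEq ι₂]
  {E₁ E₂ : Type*} [NormedAddCommGroup E₁] [NormedSpace ℂ E₁] [NormedAddCommGroup E₂] [NormedSpace ℂ E₂]
  {Φ₁ : (ι₁ → ℝ) ≃L[ℝ] E₁} {Φ₂ : (ι₂ → ℝ) ≃L[ℝ] E₂}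

/-- `g ↦ g(2g+1)` is strictly increasing. [folklore] -/
private theorem mul_two_mul_add_one_strictMono {a b : ℕ} (h : a < b) : a * (2 * a + 1) < b * (2 * b + 1) := by
  nlinarith

/-- **`Hg(X₁) = Sp(V₁, E₁)`, `Hg(X₂) = Sp(V₂, E₂)`, `dim X₁ ≠ dim X₂` ⟹ `Hg(X₁ × X₂)(ℂ) = Hg(X₁)(ℂ) × Hg(X₂)(ℂ)`**
(any two polarised Hodge-general tori of different dimensions). [cite: MoonenZarhin1999LowDim, §3 (3.1)] [cite: Gordon1997, §2.16 Proposition]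
[cite: Lange2023AbelianVarietiesComplex, §7.3.1 Prop. 7.3.2] -/
theorem IsRiemannForm.hodgeGroupC_prod_eq_blockDiagProd_of_finrank_ne [Nonempty ι₁] [Nonempty ι₂]
    [FiniteDimensional ℂ E₁] [FiniteDimensional ℂ E₂] {η₁ : E₁ [⋀^Fin 2]→L[ℝ] ℝ} {η₂ : E₂ [⋀^Fin 2]→L[ℝ] ℝ}
    (hη₁ : IsRiemannForm Φ₁ η₁) (hη₂ : IsRiemannForm Φ₂ η₂) (h₁ : hodgeGroup Φ₁ = spGroup Φ₁ η₁)
    (h₂ : hodgeGroup Φ₂ = spGroup Φ₂ η₂) (hne : finrank ℂ E₁ ≠ finrank ℂ E₂) :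
    hodgeGroupC (prodPeriod Φ₁ Φ₂) = blockDiagProd (hodgeGroupC Φ₁) (hodgeGroupC Φ₂) := by
  rcases Nat.lt_or_gt_of_ne hne with hlt | hlt
  · exact hodgeGroupC_prod_eq_blockDiagProd_of_isSimple_lieSubalgebraGL_right_of_zdim_lt Φ₁ Φ₂
      (hη₂.isSimple_lieSubalgebraGL_hodgeGroupC h₂)
      (by rw [hη₁.zdim_hodgeGroupC_eq_of_hodgeGroup_eq_spGroup h₁, hη₂.zdim_hodgeGroupC_eq_of_hodgeGroup_eq_spGroup h₂]
          exact mul_two_mul_add_one_strictMono hlt)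
  · exact hη₁.hodgeGroupC_prod_eq_blockDiagProd_of_zdim_lt Φ₂ h₁
      (by rw [hη₂.zdim_hodgeGroupC_eq_of_hodgeGroup_eq_spGroup h₂]; exact mul_two_mul_add_one_strictMono hlt)

/-- Real points for two Hodge-general factors of different dimensions. [cite: MoonenZarhin1999LowDim, §3 (3.1)] -/
theorem IsRiemannForm.hodgeGroup_prod_eq_of_finrank_ne [Nonempty ι₁] [Nonempty ι₂]
    [FiniteDimensional ℂ E₁] [FiniteDimensional ℂ E₂] {η₁ : E₁ [⋀^Fin 2]→L[ℝ] ℝ} {η₂ : E₂ [⋀^Fin 2]→L[ℝ] ℝ}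
    (hη₁ : IsRiemannForm Φ₁ η₁) (hη₂ : IsRiemannForm Φ₂ η₂) (h₁ : hodgeGroup Φ₁ = spGroup Φ₁ η₁)
    (h₂ : hodgeGroup Φ₂ = spGroup Φ₂ η₂) (hne : finrank ℂ E₁ ≠ finrank ℂ E₂) :
    hodgeGroup (prodPeriod Φ₁ Φ₂) = ((hodgeGroup Φ₁).prod (hodgeGroup Φ₂)).map (blockDiag ι₁ ι₂) :=
  hodgeGroup_prod_eq_of_hodgeGroupC_prod_eq (hη₁.hodgeGroupC_prod_eq_blockDiagProd_of_finrank_ne hη₂ h₁ h₂ hne)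

/-- **TWO STABLY NONDEGENERATE POLARISED TORI WITH `End_ℚ = ℚ` AND DIFFERENT DIMENSIONS: (D) holds on every power of
`X₁ × X₂`** (every Hodge class on every `(X₁ × X₂)ᵏ` is generated by divisor classes).
[cite: Gordon1999HodgeAVSurvey, Thm. 7.5 and Thm. 7.6.2] [cite: MoonenZarhin1999LowDim, §3 (3.1)] -/
theorem IsRiemannForm.forall_divisorClasses_powPeriod_prod_eq_hodgeClasses_of_finrank_ne [Nonempty ι₁] [Nonempty ι₂]
    [FiniteDimensional ℂ E₁] [FiniteDimensional ℂ E₂] {η₁ : E₁ [⋀^Fin 2]→L[ℝ] ℝ} {η₂ : E₂ [⋀^Fin 2]→L[ℝ] ℝ}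
    (hη₁ : IsRiemannForm Φ₁ η₁) (hη₂ : IsRiemannForm Φ₂ η₂) (hE₁ : endAlgRat Φ₁ = ⊥) (hE₂ : endAlgRat Φ₂ = ⊥)
    (hX₁ : ∀ k p, divisorClasses (powPeriod Φ₁ k) p = hodgeClasses (powPeriod Φ₁ k) p)
    (hX₂ : ∀ k p, divisorClasses (powPeriod Φ₂ k) p = hodgeClasses (powPeriod Φ₂ k) p)
    (hne : finrank ℂ E₁ ≠ finrank ℂ E₂) :
    ∀ k p, divisorClasses (powPeriod (prodPeriod Φ₁ Φ₂) k) p = hodgeClasses (powPeriod (prodPeriod Φ₁ Φ₂) k) p :=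
  forall_divisorClasses_powPeriod_prod_eq_hodgeClasses_of_hodgeGroupC_prod_eq
    (hη₁.hodgeGroupC_prod_eq_blockDiagProd_of_finrank_ne hη₂
      ((hη₁.hodgeGroup_eq_spGroup_iff_forall_divisorClasses_eq_hodgeClasses_and_endAlgRat_eq_bot).2 ⟨hX₁, hE₁⟩)
      ((hη₂.hodgeGroup_eq_spGroup_iff_forall_divisorClasses_eq_hodgeClasses_and_endAlgRat_eq_bot).2 ⟨hX₂, hE₂⟩) hne)
    hX₁ hX₂

end Two

end ComplexTorus

end Literature.Geometry.Kaehler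

end
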